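import Literature.NumberTheory.EllipticCurves.KatoFineSelmerDualGraded
import Mathlib.Algebra.Module.CharacterModule
import HarnessLib

set_option autoImplicit false

-- the summit and its single problem are both named `BirchSwinnertonDyer` (registry layout D-0017)
set_option linter.dupNamespace false

/-!
# Pontryagin duality for the dual fine Selmer datum, the two directions needed by the bounded-defect
# test-pair supply (stub 1s `stub_testPairSupplyPkX9` of line `graded_euler_loss`, crux `KatoDivisibilityX9` =
# stmt-BirchSwinnertonDyer-20547): iterated pairing identities, the EASY direction (a discrete witness forces
# `T^J P^n X₀ ⊄ P^{n+1} X₀`), and the ANNIHILATOR computation `Ann_{X₀}(Sel₀[p^k, θ^m]) = T^m X₀ + P^k X₀`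

Seat `bsd-line-k6-p4` (prover-bsd-line-k6-p4-g5-0, 5th LEAD).  THEOREMS ONLY, sorry-free, no definition, nothing asserted
about any curve; `--supports stmt-BirchSwinnertonDyer-20547 --as helper` (service file of the stub file
`…KatoDivisibilityX9StubTestPairSupplyPkX9.lean`).  For a number field `K`, `κ : ZpExtension K p` with topological
generator `γ`, `S = Sel₀(K_∞, E[p^∞]) = W.fineSelmerInfty κ` with `θ = conj_γ − 1` (`W.conjFineSelmerInfty κ γ − 1`), and
ANY dual datum `Y : W.FineSelmerDualData κ γ` (`toDual : Y.X ≅ Hom(S, ℚ/ℤ)`, `T ↔ θ`, `C c ↔ c`):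

* §1 two generic character lemmas for `ℚ/ℤ = AddCircle 1` (injective `ℤ`-module, Mathlib `Module.Baer.of_divisible`):
  extension from a subgroup, and factorisation through an endomorphism whose kernel is killed;
* §2 `toDual (T^m • x) s = toDual x (θ^m s)`, `toDual ((C p)^k • x) s = toDual x (p^k • s)`, and the coercion
  `((θ^m s : S) : H¹) = (conj_γ − id)^[m] s`;
* §3 EASY direction: if some `t ∈ S` has `θ^J (p^n • t) ≠ 0` and `p^{n+1} t = 0`… more precisely if `θ^J(p^n t) ≠ 0` then
  NOT every `T^J (C p)^n • x` lies in `(C p)^{n+1} • X` (characters separate points);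
* §4 ANNIHILATOR: if `toDual z` kills every `t ∈ S` with `p^k • t = 0` and `θ^m t = 0`, then
  `z = T^m • x₁ + (C p)^k • x₂` (factor through `θ^m` on `S[p^k]`, extend, factor the rest through `p^k`, extend; then
  `toDual` is injective).

References: R. Greenberg, LNM 1716 (1999) §1 p. 60 (Pontryagin duality of `Λ`-modules) [GreenbergLNM1716]; L. Washington,
GTM 83 §13.2 [Washington1997].
-/

noncomputable section

open scoped Classical

universe u

namespace Summit.BirchSwinnertonDyer.BirchSwinnertonDyer.Theorems.OneSidedTwistSqueezeX9KatoDivisibilityX9PontryaginAnnihilator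

/-! ## §1 Characters with values in `ℚ/ℤ`: extension and factorisation -/

section Characters

variable {A : Type*} [AddCommGroup A]

/-- **Extension of a `ℚ/ℤ`-valued character from a subgroup** (`ℚ/ℤ` is an injective abelian group — Baer +
divisibility, Mathlib). [folklore] -/
theorem exists_character_extend (B : AddSubgroup A) (χ : B →+ AddCircle (1 : ℚ)) :
    ∃ χ' : A →+ AddCircle (1 : ℚ), ∀ b : B, χ' b = χ b := by
  obtain ⟨χ', h⟩ := (Module.Baer.of_divisible (AddCircle (1 : ℚ))).extension_property_addMonoidHom B.subtype
    B.subtype_injective χ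
  exact ⟨χ', fun b => by rw [← h]; rfl⟩

/-- **Factorisation of a `ℚ/ℤ`-valued character through an endomorphism**: if `χ` kills `ker f` then `χ = χ' ∘ f` for
some character `χ'` (factor through `A ⧸ ker f ≅ range f`, then extend from `range f`). [folklore] -/
theorem exists_character_comp_eq_of_ker (f : A →+ A) (χ : A →+ AddCircle (1 : ℚ))
    (hχ : ∀ a, f a = 0 → χ a = 0) : ∃ χ' : A →+ AddCircle (1 : ℚ), ∀ a, χ' (f a) = χ a := by
  -- `χ` descends to `A ⧸ ker f`, transported to `range f`
  let χq : A ⧸ f.ker →+ AddCircle (1 : ℚ) := QuotientAddGroup.lift f.ker χ fun a ha => hχ a ha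
  let e : A ⧸ f.ker ≃+ f.range := QuotientAddGroup.quotientKerEquivRange f
  let χr : f.range →+ AddCircle (1 : ℚ) := χq.comp e.symm.toAddMonoidHom
  obtain ⟨χ', hχ'⟩ := exists_character_extend f.range χr
  refine ⟨χ', fun a => ?_⟩
  have he : e (QuotientAddGroup.mk a) = ⟨f a, a, rfl⟩ := rfl
  rw [show f a = ((⟨f a, a, rfl⟩ : f.range) : A) from rfl, hχ' ⟨f a, a, rfl⟩]
  change χq (e.symm ⟨f a, a, rfl⟩) = χ a
  rw [← he, AddEquiv.symm_apply_apply]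
  rfl

/-- Characters separate points (Mathlib `CharacterModule.eq_zero_of_character_apply`, restated for `→+`). [folklore] -/
theorem eq_zero_of_forall_character {a : A} (h : ∀ χ : A →+ AddCircle (1 : ℚ), χ a = 0) : a = 0 :=
  CharacterModule.eq_zero_of_character_apply h

end Characters

/-! ## §2 Iterated pairing identities for a dual fine Selmer datum -/

section Pairing

open Literature.NumberTheory.EllipticCurves WeierstrassCurve

variable {K : Type u} [Field K] [NumberField K] (W : WeierstrassCurve K) {p : ℕ} [Fact p.Prime]
  (κ : ZpExtension K p) {γ : Field.absoluteGaloisGroup K}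

/-- Coercion of the iterates of `θ = conj_γ − 1` on `Sel₀`: `((θ^m s : Sel₀) : H¹(K_∞, E[p^∞])) = (conj_γ − id)^[m] s`.
[cite: GreenbergLNM1716, §1 p. 60 (after Conj. 1.3)] -/
theorem coe_conjFineSelmerInfty_sub_one_pow_apply (γ : Field.absoluteGaloisGroup K) (m : ℕ) (s : W.fineSelmerInfty κ) :
    ((((W.conjFineSelmerInfty κ γ - 1) ^ m) s : W.fineSelmerInfty κ) : W.subgroupH1 p κ.kerSubgroup) =
      (⇑(W.conjH1 p κ.kerSubgroup γ - AddMonoidHom.id (W.subgroupH1 p κ.kerSubgroup)))^[m]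
        (s : W.subgroupH1 p κ.kerSubgroup) := by
  induction m generalizing s with
  | zero => rfl
  | succ m ih =>
    rw [pow_succ', AddMonoid.End.coe_mul, Function.comp_apply, Function.iterate_succ_apply', ← ih,
      W.coe_conjFineSelmerInfty_sub_one_apply κ γ]
    rfl

variable (Y : W.FineSelmerDualData κ γ)

/-- `T` acts as `θ = conj_γ − 1` through the pairing: `toDual (T • x) s = toDual x (θ s)`.
[cite: GreenbergLNM1716, §1 p. 60 (after Conj. 1.3)] -/
theorem toDual_X_smul (x : Y.X) (s : W.fineSelmerInfty κ) :
    Y.toDual ((PowerSeries.X : IwasawaAlgebra p) • x) s = Y.toDual x ((W.conjFineSelmerInfty κ γ - 1) s) := by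
  rw [Y.toDual_T_smul, IwasawaDual.End_sub_apply, AddMonoid.End.one_apply, map_sub]
  rfl

/-- Iterated: `toDual (T^m • x) s = toDual x (θ^m s)`. [cite: GreenbergLNM1716, §1 p. 60 (after Conj. 1.3)] -/
theorem toDual_X_pow_smul (m : ℕ) (x : Y.X) (s : W.fineSelmerInfty κ) :
    Y.toDual ((PowerSeries.X : IwasawaAlgebra p) ^ m • x) s =
      Y.toDual x (((W.conjFineSelmerInfty κ γ - 1) ^ m) s) := by
  induction m generalizing s with
  | zero => rw [pow_zero, one_smul, pow_zero, AddMonoid.End.one_apply]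
  | succ m ih =>
    rw [pow_succ', mul_smul, toDual_X_smul, ih, ← Function.comp_apply (f := ⇑((W.conjFineSelmerInfty κ γ - 1) ^ m)),
      ← AddMonoid.End.coe_mul, ← pow_succ]

/-- `(C p)^k` acts as `p^k` through the pairing: `toDual ((C p)^k • x) s = toDual x (p^k • s)`.
[cite: GreenbergLNM1716, §1 p. 60 (after Conj. 1.3)] -/
theorem toDual_C_pow_smul (k : ℕ) (x : Y.X) (s : W.fineSelmerInfty κ) :
    Y.toDual ((PowerSeries.C (p : ℤ_[p]) : IwasawaAlgebra p) ^ k • x) s = Y.toDual x (p ^ k • s) :=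
  IwasawaDual.toDual_C_pow_smul Y.toDual_C_smul
    (fun s' => WeierstrassCurve.exists_pow_smul_fineSelmerInfty_eq_zero (W := W) (κ := κ) s') x s k

end Pairing

/-! ## §3 The EASY direction: a discrete witness forces `T^J (C p)^n X ⊄ (C p)^{n+1} X` -/

section Easy

open Literature.NumberTheory.EllipticCurves WeierstrassCurve

variable {K : Type u} [Field K] [NumberField K] (W : WeierstrassCurve K) {p : ℕ} [Fact p.Prime]
  (κ : ZpExtension K p) {γ : Field.absoluteGaloisGroup K} (Y : W.FineSelmerDualData κ γ)

/-- **EASY direction.**  If `θ^J (p^n • t) ≠ 0` for some `t ∈ Sel₀` with `p^{n+1} • t = 0`, then some `x ∈ X₀` has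
`T^J (C p)^n • x ∉ (C p)^{n+1} • X₀`: otherwise `toDual x (θ^J p^n t) = toDual (T^J (C p)^n x) t = toDual ((C p)^{n+1} x') t =
toDual x' (p^{n+1} t) = 0` for every `x`, and characters separate points (`toDual` is onto).
[cite: GreenbergLNM1716, §1 p. 60 (after Conj. 1.3)] -/
theorem exists_not_mem_of_witness {J n : ℕ} (t : W.fineSelmerInfty κ) (hpt : p ^ (n + 1) • t = 0)
    (hθ : ((W.conjFineSelmerInfty κ γ - 1) ^ J) (p ^ n • t) ≠ 0) :
    ∃ x : Y.X, ∀ x' : Y.X, (PowerSeries.X : IwasawaAlgebra p) ^ J •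
      ((PowerSeries.C (p : ℤ_[p]) : IwasawaAlgebra p) ^ n • x) ≠
        (PowerSeries.C (p : ℤ_[p]) : IwasawaAlgebra p) ^ (n + 1) • x' := by
  by_contra hall
  push Not at hall
  apply hθ
  apply eq_zero_of_forall_character
  intro χ
  obtain ⟨x, rfl⟩ := Y.bijective.2 χ
  obtain ⟨x', hx'⟩ := hall x
  have h : Y.toDual ((PowerSeries.X : IwasawaAlgebra p) ^ J •
      ((PowerSeries.C (p : ℤ_[p]) : IwasawaAlgebra p) ^ n • x)) t =
      Y.toDual ((PowerSeries.C (p : ℤ_[p]) : IwasawaAlgebra p) ^ (n + 1) • x') t := by rw [hx']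
  rw [toDual_X_pow_smul, toDual_C_pow_smul, toDual_C_pow_smul, hpt, map_zero] at h
  rw [map_nsmul]
  exact h

end Easy

/-! ## §4 The ANNIHILATOR of `Sel₀[p^k, θ^m]` in `X₀` is `T^m X₀ + (C p)^k X₀` -/

section Annihilator

open Literature.NumberTheory.EllipticCurves WeierstrassCurve

variable {K : Type u} [Field K] [NumberField K] (W : WeierstrassCurve K) {p : ℕ} [Fact p.Prime]
  (κ : ZpExtension K p) {γ : Field.absoluteGaloisGroup K} (Y : W.FineSelmerDualData κ γ)

/-- `θ = conj_γ − 1` commutes with multiplication by `p^k` on `Sel₀`, so it preserves `Sel₀[p^k]`. [folklore] -/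
theorem nsmul_conjFineSelmerInfty_sub_one_pow (k m : ℕ) (s : W.fineSelmerInfty κ) :
    ((W.conjFineSelmerInfty κ γ - 1) ^ m) (p ^ k • s) = p ^ k • ((W.conjFineSelmerInfty κ γ - 1) ^ m) s :=
  map_nsmul _ _ _

/-- **ANNIHILATOR computation** (the hard direction of Pontryagin duality at finite level).  If `toDual z` kills every
`t ∈ Sel₀` with `p^k • t = 0` and `θ^m t = 0`, then `z = T^m • x₁ + (C p)^k • x₂` for some `x₁, x₂ ∈ X₀`.
[cite: GreenbergLNM1716, §1 p. 60 (after Conj. 1.3)] -/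
theorem exists_eq_X_pow_smul_add_C_pow_smul (k m : ℕ) (z : Y.X)
    (hz : ∀ t : W.fineSelmerInfty κ, p ^ k • t = 0 → ((W.conjFineSelmerInfty κ γ - 1) ^ m) t = 0 → Y.toDual z t = 0) :
    ∃ x₁ x₂ : Y.X, z = (PowerSeries.X : IwasawaAlgebra p) ^ m • x₁ +
      (PowerSeries.C (p : ℤ_[p]) : IwasawaAlgebra p) ^ k • x₂ := by
  set θ : AddMonoid.End (W.fineSelmerInfty κ) := W.conjFineSelmerInfty κ γ - 1 with hθdef
  -- the `p^k`-torsion `Sk` of `Sel₀` and `θ^m` restricted to it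
  let Sk : AddSubgroup (W.fineSelmerInfty κ) := (nsmulAddMonoidHom (p ^ k) : W.fineSelmerInfty κ →+ _).ker
  have hSk : ∀ t, t ∈ Sk ↔ p ^ k • t = 0 := fun t => by
    change nsmulAddMonoidHom (p ^ k) t = 0 ↔ _
    rw [nsmulAddMonoidHom_apply]
  have hθSk : ∀ t ∈ Sk, (θ ^ m) t ∈ Sk := fun t ht => by
    rw [hSk] at ht ⊢
    rw [hθdef, ← nsmul_conjFineSelmerInfty_sub_one_pow W κ k m t, ht, map_zero]
  let f : Sk →+ Sk := ((θ ^ m : AddMonoid.End (W.fineSelmerInfty κ)) : W.fineSelmerInfty κ →+ _).restrict Sk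
    |>.codRestrict Sk fun t => hθSk t t.2
  have hf : ∀ t : Sk, ((f t : Sk) : W.fineSelmerInfty κ) = (θ ^ m) t := fun _ => rfl
  -- step 1: `toDual z` restricted to `Sk` factors through `θ^m`
  let χ : W.fineSelmerInfty κ →+ AddCircle (1 : ℚ) := Y.toDual z
  obtain ⟨χ₁'', hχ₁''⟩ := exists_character_comp_eq_of_ker f (χ.comp Sk.subtype) fun t ht =>
    hz t ((hSk t).mp t.2) (by
      have := congrArg (fun u : Sk => (u : W.fineSelmerInfty κ)) ht
      simpa [hf] using this)
  obtain ⟨χ₁, hχ₁⟩ := exists_character_extend Sk χ₁''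
  obtain ⟨x₁, hx₁⟩ := Y.bijective.2 χ₁
  -- step 2: `χ − toDual (T^m x₁)` kills `Sk`, hence factors through `p^k`
  let χ₂ : W.fineSelmerInfty κ →+ AddCircle (1 : ℚ) :=
    χ - Y.toDual ((PowerSeries.X : IwasawaAlgebra p) ^ m • x₁)
  have hχ₂ : ∀ t, p ^ k • t = 0 → χ₂ t = 0 := fun t ht => by
    have ht' : t ∈ Sk := (hSk t).mpr ht
    change χ t - Y.toDual ((PowerSeries.X : IwasawaAlgebra p) ^ m • x₁) t = 0
    rw [toDual_X_pow_smul, hx₁, ← hθdef]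
    have h1 := hχ₁ ⟨(θ ^ m) t, hθSk t ht'⟩
    have h2 := hχ₁'' ⟨t, ht'⟩
    rw [sub_eq_zero]
    change χ t = χ₁ ((θ ^ m) t)
    rw [h1]
    rw [show f ⟨t, ht'⟩ = ⟨(θ ^ m) t, hθSk t ht'⟩ from Subtype.ext (hf ⟨t, ht'⟩)] at h2
    rw [h2]
    rfl
  obtain ⟨χ₃, hχ₃⟩ := exists_character_comp_eq_of_ker (nsmulAddMonoidHom (p ^ k)) χ₂ fun t ht => hχ₂ t
    (by rwa [nsmulAddMonoidHom_apply] at ht)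
  obtain ⟨x₂, hx₂⟩ := Y.bijective.2 χ₃
  -- assemble: `toDual z = toDual (T^m x₁ + (C p)^k x₂)`
  refine ⟨x₁, x₂, Y.bijective.1 (AddMonoidHom.ext fun t => ?_)⟩
  rw [map_add, AddMonoidHom.add_apply, toDual_C_pow_smul, hx₂, ← nsmulAddMonoidHom_apply (p ^ k) t, hχ₃]
  change χ t = _ + (χ t - Y.toDual ((PowerSeries.X : IwasawaAlgebra p) ^ m • x₁) t)
  abel

end Annihilator

end Summit.BirchSwinnertonDyer.BirchSwinnertonDyer.Theorems.OneSidedTwistSqueezeX9KatoDivisibilityX9PontryaginAnnihilator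

end
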